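import Summits.HubbardSuperconductivity.HubbardSuperconductivity.Theorems.DeformationLadderLadderThesisNormalForms

/-!
# Route `TwistGap`, target `TgThesis` (`stmt-HubbardSuperconductivity-1508`): the LocalStability corollary

The card's corollary of `S⁺`, recorded in the texts of `TgThesis` and `TgStabilityEquivalence`
("worth filing with --supports"), at a fixed side `L` and sector `K = szSector N 0`
(`H_L = hubbardTorus 2 L 1 U`, `E₀ = minEnergyOn H_L K`, `LRO(φ) = L⁻⁴ Re⟨φ, Δ_dᴴΔ_d φ⟩`):

if `c ≤ LRO(φ) + λ (Re⟨φ, H_L φ⟩ − E₀)` for every unit `φ ∈ K` (the finite-`L` content of `S⁺`,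
`λ ≥ 0`), then for EVERY perturbation `B` whose numerical range on unit vectors of `K` is bounded by
`β` (`|Re⟨v, B v⟩| ≤ β`; e.g. `β = ‖B‖` for Hermitian `B`), every normalised sector ground state
`φ` of `H_L + B` has `LRO(φ) ≥ c − 2λβ` (`lro_ge_of_perturbed_groundState`). Two lines:
`E_B ≤ E₀ + β` by the variational principle (`minEnergyOn_add_le_of_numericalRange`), and
`Re⟨φ, H_L φ⟩ = E_B − Re⟨φ, B φ⟩ ≤ E₀ + 2β`. No Hermiticity, gap or sector-preservation hypothesis
on `B` is needed in this direction (if `H_L + B` has no sector ground state the claim is empty).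
Contrast: stability theory of gapped ground states (Bachmann–Michalakis–Nachtergaele–Sims 2012)
needs a spectral gap; here the sector is gapless and the input is the coercivity `S⁺`.

Sources: the item texts of `TgThesis` / `TgStabilityEquivalence` (planner card `TwistGap`);
H. Tasaki, *Physics and Mathematics of Quantum Many-Body Systems* (2020) §2.1 (variational
principle). No definition is introduced.
-/

set_option linter.dupNamespace false

noncomputable section

namespace Summit.HubbardSuperconductivity.HubbardSuperconductivity.Theorems.TwistGap

open Matrix Literature.MathematicalPhysics.QuantumLattice Literature.Probability.LatticeModels

variable (L : ℕ) [NeZero L]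

omit [NeZero L] in
/-- **Variational shift bound.** If `|Re⟨v, B v⟩| ≤ β` on the unit vectors of a sector `K` that
contains a unit vector, then `minEnergyOn (A + B) K ≤ minEnergyOn A K + β` (every unit trial vector
of `K` for `A` is one for `A + B`). Tasaki (2020) §2.1, (2.1.6). [folklore] -/
theorem minEnergyOn_add_le_of_numericalRange
    (A B : Matrix (Finset (Orb (FermionTorus 2 L))) (Finset (Orb (FermionTorus 2 L))) ℂ)
    (K : Submodule ℂ (Fock (Orb (FermionTorus 2 L)))) {β : ℝ}
    (hB : ∀ v ∈ K, star v ⬝ᵥ v = 1 → |(star v ⬝ᵥ B *ᵥ v).re| ≤ β)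
    (hK : ∃ ψ ∈ K, star ψ ⬝ᵥ ψ = 1) :
    (A + B).minEnergyOn K ≤ A.minEnergyOn K + β := by
  obtain ⟨ψ₀, hψ₀K, hψ₀⟩ := hK
  rw [← sub_le_iff_le_add]
  refine le_csInf ⟨_, ψ₀, hψ₀K, hψ₀, rfl⟩ ?_
  rintro E ⟨ψ, hψK, hψ, rfl⟩
  have h1 := minEnergyOn_le_re_rayleigh (A + B) K hψK hψ
  rw [add_mulVec, dotProduct_add, Complex.add_re] at h1
  have h2 := (le_abs_self _).trans (hB ψ hψK hψ)
  linarith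

/-- **LocalStability** (corollary of `S⁺` at fixed `L`, sector `(N, S^z = 0)`): if
`c ≤ LRO(φ) + λ(Re⟨φ, H_L φ⟩ − E₀)` on unit sector vectors (`λ ≥ 0`) and `|Re⟨v, B v⟩| ≤ β` on unit
sector vectors, then every normalised sector ground state `φ` of `H_L + B` has
`LRO(φ) ≥ c − 2λβ`: `Re⟨φ, H_L φ⟩ = E_B − Re⟨φ, B φ⟩ ≤ (E₀ + β) + β`. The `d`-wave LRO forced by
`S⁺` survives every perturbation that is small in numerical range, although the sector is gapless.
Tasaki (2020) §2.1 for the variational principle; the statement is the TwistGap card's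
LocalStability. [folklore] -/
theorem lro_ge_of_perturbed_groundState (U : ℝ) {lam c β : ℝ} (hlam : 0 ≤ lam) (N : ℕ)
    (hS : ∀ φ : Fock (Orb (FermionTorus 2 L)), φ ∈ szSector (Λ := FermionTorus 2 L) N 0 →
      star φ ⬝ᵥ φ = 1 →
        c ≤ (expect ((pairField dWaveFormFactor L)ᴴ * pairField dWaveFormFactor L) φ).re /
            (L : ℝ) ^ 4 +
          lam * ((expect (hubbardTorus 2 L 1 U) φ).re -
            (hubbardTorus 2 L 1 U).minEnergyOn (szSector N 0)))
    (B : Matrix (Finset (Orb (FermionTorus 2 L))) (Finset (Orb (FermionTorus 2 L))) ℂ)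
    (hB : ∀ v ∈ szSector (Λ := FermionTorus 2 L) N 0, star v ⬝ᵥ v = 1 →
      |(star v ⬝ᵥ B *ᵥ v).re| ≤ β)
    {φ : Fock (Orb (FermionTorus 2 L))} (hφ1 : star φ ⬝ᵥ φ = 1)
    (hφ : IsGroundStateInSector (hubbardTorus 2 L 1 U + B) N 0 φ) :
    c - 2 * lam * β ≤
      (expect ((pairField dWaveFormFactor L)ᴴ * pairField dWaveFormFactor L) φ).re / (L : ℝ) ^ 4 := by
  obtain ⟨hmem, -, heig⟩ := hφ
  -- `Re⟨φ, (H + B) φ⟩ = E_B ≤ E₀ + β`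
  have h1 : (star φ ⬝ᵥ (hubbardTorus 2 L 1 U + B) *ᵥ φ).re =
      (hubbardTorus 2 L 1 U + B).minEnergyOn (szSector N 0) := by
    rw [heig, dotProduct_smul, hφ1, smul_eq_mul, mul_one, Complex.ofReal_re]
  rw [add_mulVec, dotProduct_add, Complex.add_re] at h1
  have h2 := minEnergyOn_add_le_of_numericalRange L (hubbardTorus 2 L 1 U) B (szSector N 0) hB
    ⟨φ, hmem, hφ1⟩
  -- `-Re⟨φ, B φ⟩ ≤ β`
  have h3 := (neg_le_abs _).trans (hB φ hmem hφ1)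
  -- `S⁺` at `φ`
  have h4 := hS φ hmem hφ1
  unfold expect at h4 ⊢
  have h5 : lam * ((star φ ⬝ᵥ hubbardTorus 2 L 1 U *ᵥ φ).re -
      (hubbardTorus 2 L 1 U).minEnergyOn (szSector N 0)) ≤ lam * (2 * β) :=
    mul_le_mul_of_nonneg_left (by linarith) hlam
  linarith

end Summit.HubbardSuperconductivity.HubbardSuperconductivity.Theorems.TwistGap
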